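import Summits.QuantumFields.YangMills.Theorems.AlphaInputsT3ACv3RegionalThm1Carrier
import Literature.MathematicalPhysics.QuantumFieldTheory.Balaban1983to89.B10NestedMinimizer
import HarnessLib

/-!
# `AlphaInputsT3ACv3RegionalThm1CarrierData` — THE NORMALISED MULTI-LEVEL DATUM MAP OF THE REGIONAL PROBLEM (3) AND ITS (4)-INVARIANCE:
# `datumE`∕`ofDataE` (the `Averaging`-family twin of LQB's `B10Eq42TorusConstraint.KData`∕`datum`∕`ofData`), `datumE = ofDataE ↔ ConstraintOn`,
# and `ConstraintOn` is invariant under print's group (4) — UNCONDITIONALLY for an `Averaging` family ([Balaban1985Averaging] (11) iterated)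

Cell `ym3-torus` (HUMAN RULING D-0037, rung R3 — finite-torus SU(2) YM₃, NOT the Clay problem), seat `ym-ust-19936-w4` (gen 4), WIDTH helper on
stmt-QuantumFields-19936 `HistoryTailL`; LEAD B1 PLAN v2 (2)(a) (★w6-19936 g2's (n-1) LOCATE (2)(a): LQB's `B11Dict.inB_iff`∕`LevelMin.datum` want the datum
type to BE the datum).  Companion of ✓`AlphaInputsT3ACv3RegionalThm1Carrier` ([Balaban1985Variational] Thm 1's regional carrier; its (3) is `RegionalVP.ConstraintOn`,
its (4) `RegionalVP.TrivialOn`).  `--supports stmt-QuantumFields-19936 --as helper`; count-neutral; review lane (two definitions).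

WHAT (generic over `P : Params`, a gauge group `G` and an averaging family `av : ∀ j, Averaging P j G`; the route's is `fun j => blockAvg ℰp`).
§1 **`datumE av k Λ U`** — the NORMALISED datum map `U ↦ ((avʲ U)↾(bonds on Λ_j))_{j ≤ k}`, junk value `1` off the constrained bonds (print's «`Ūʲ↾Λ_j`»,
[Balaban1985UV3] (42) «`U: Ūʲ = V_j on Λ_j, j = 0, 1, …, k`»; LQB's `datum` with `avgT ↦ Averaging.iter av`, `bondsIn ↦ bondsOn`, junk `0 ↦ 1`);
**`ofDataE k Λ 𝓥`** — the normal form of multi-level data; ★`datumE_eq_ofDataE_iff : datumE av k Λ U = ofDataE k Λ 𝓥 ↔ ConstraintOn av k Λ 𝓥 U`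
(«`C U = y ↔ (3)`», the dictionary clause `B11Dict.inB_iff` ON NORMALISED DATA: `constraintOn_iff_datumE_eq`), `fibK_datumE` (the cell's abstract fibre
`B10NestedMinimizer.fibK (datumE av k Λ) (ofDataE k Λ 𝓥)` IS the (3)-constraint set), normalisation `ofDataE_idem`∕`ofDataE_datumE`, `constraintOn_ofDataE_iff`
(the constraint reads the data through their normal form only), `constraintOn_datumE_self` (every `U` satisfies the constraint of its own datum).
§2 ★`constraintOn_gaugeAct` — [Balaban1985Variational] p.278 «the space `𝔅_k(𝔅_k, V)` is invariant with respect to gauge transformations `u` satisfying (4)»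
for ANY averaging family in the standing range `k ≤ m + K`: `TrivialOn k Λ u → ConstraintOn av k Λ 𝓥 U → ConstraintOn av k Λ 𝓥 (U^u)` — by the
family's covariance ([Balaban1985Averaging] (11) «`\overline{U^u} = (Ū)^u`», the tree's `Setup.Averaging.covariant` iterated: `T4Continuum.iter_gaugeAct`,
`transfUp u j y = u (toFine j y)`) and `u = 1` at both anchors; NO regularity hypothesis (contrast LQB's `B10Eq68TorusRegularity.constraint42_gaugeAct`
for print's non-linear `avgT`, which needs `U ∈ 𝔘_k`); `iter_gaugeAct_apply`, `datumE_gaugeAct` (the datum is (4)-invariant), `trivialOn_inv`∕`gaugeAct_inv_gaugeAct`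
and the `↔` form `constraintOn_gaugeAct_iff`.

HONEST FRAMING.  Bookkeeping (two definitions + unfoldings + one covariance computation); nothing of Bałaban's estimates is asserted; B1, NODE O d = 3, the
stub `stub_laneRecordsV3Chi` and the crux are NOT claimed; YM₃ on T³ = rung R3 — not d = 4, not infinite volume, no mass gap, not Clay.

References: T. Bałaban, CMP 102 (1985) 277–309 [Balaban1985Variational] ((3)–(4) p.278); CMP 102 (1985) 255–275 [Balaban1985UV3] ((42) p.266);
CMP 98 (1985) 17–51 [Balaban1985Averaging] ((11) p.19).
-/

set_option autoImplicit false

noncomputable section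

namespace Summit.QuantumFields.YangMills.Theorems.RegionalVP

open Set
open Literature.MathematicalPhysics.QuantumFieldTheory.Balaban1983to89
open Literature.MathematicalPhysics.QuantumFieldTheory.Balaban1983to89.B10Eq38TorusDomains (toFine toFine_succ)
open Literature.MathematicalPhysics.QuantumFieldTheory.Balaban1983to89.T4Continuum (transfUp iter_gaugeAct)
open Literature.MathematicalPhysics.QuantumFieldTheory.Balaban1983to89.B10NestedMinimizer (fibK)

variable {P : Params} {G : Type*} [GaugeGroup G]

/-! ## §1 The normalised datum map and the normal form of data -/

section Data

open Classical in
/-- **THE NORMALISED MULTI-LEVEL DATUM MAP** `U ↦ ((avʲ U)↾(bonds on Λ_j))_{j ≤ k}`: the `j`-fold average on the constrained bonds `bondsOn j (Λ j)` of the levels `j ≤ k`,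
the junk value `1` elsewhere (LQB's `B10Eq42TorusConstraint.datum` for an `Averaging` family, in the group). [cite: Balaban1985UV3, (42) p.266] -/
def datumE (av : ∀ j, Averaging P j G) (k : ℕ) (Λ : ℕ → Set (Site P 0)) (U : GaugeField P 0 G) : (j : ℕ) → GaugeField P j G :=
  fun j b => if j ≤ k ∧ b ∈ bondsOn j (Λ j) then Averaging.iter av j U b else 1

open Classical in
/-- **THE NORMAL FORM OF MULTI-LEVEL DATA**: the data's values on the constrained bonds of the levels `j ≤ k`, `1` elsewhere (LQB's `ofData`; «V is a fixed gauge field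
configuration define on `𝔅_k`», [Balaban1985Variational] p.278). [cite: Balaban1985Variational, (3) p.278] -/
def ofDataE (k : ℕ) (Λ : ℕ → Set (Site P 0)) (𝓥 : (j : ℕ) → GaugeField P j G) : (j : ℕ) → GaugeField P j G :=
  fun j b => if j ≤ k ∧ b ∈ bondsOn j (Λ j) then 𝓥 j b else 1

variable {av : ∀ j, Averaging P j G} {k : ℕ} {Λ : ℕ → Set (Site P 0)}

open Classical in
/-- `datumE` on a constrained bond is the average. [cite: Balaban1985UV3, (42) p.266] -/
theorem datumE_of_mem {U : GaugeField P 0 G} {j : ℕ} (hj : j ≤ k) {b : PBond P j} (hb : b ∈ bondsOn j (Λ j)) :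
    datumE av k Λ U j b = Averaging.iter av j U b := by
  unfold datumE; rw [if_pos ⟨hj, hb⟩]

open Classical in
/-- `datumE` off the constrained bonds (or above level `k`) is `1`. [cite: Balaban1985UV3, (42) p.266] -/
theorem datumE_of_not {U : GaugeField P 0 G} {j : ℕ} {b : PBond P j} (h : ¬ (j ≤ k ∧ b ∈ bondsOn j (Λ j))) : datumE av k Λ U j b = 1 := by
  unfold datumE; rw [if_neg h]

open Classical in
/-- `ofDataE` on a constrained bond is the datum. [cite: Balaban1985Variational, (3) p.278] -/
theorem ofDataE_of_mem {𝓥 : (j : ℕ) → GaugeField P j G} {j : ℕ} (hj : j ≤ k) {b : PBond P j} (hb : b ∈ bondsOn j (Λ j)) :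
    ofDataE k Λ 𝓥 j b = 𝓥 j b := by
  unfold ofDataE; rw [if_pos ⟨hj, hb⟩]

open Classical in
/-- `ofDataE` off the constrained bonds (or above level `k`) is `1`. [cite: Balaban1985Variational, (3) p.278] -/
theorem ofDataE_of_not {𝓥 : (j : ℕ) → GaugeField P j G} {j : ℕ} {b : PBond P j} (h : ¬ (j ≤ k ∧ b ∈ bondsOn j (Λ j))) : ofDataE k Λ 𝓥 j b = 1 := by
  unfold ofDataE; rw [if_neg h]

/-- ★ **`C U = y ↔ (3)`**: the normalised datum of `U` is the normal form of the data `𝓥` iff `U` satisfies the multi-level constraint «`Ūʲ = 𝓥_j` on `Λ_j`, `j ≤ k`».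
[cite: Balaban1985Variational, (3) p.278; Balaban1985UV3, (42) p.266] -/
theorem datumE_eq_ofDataE_iff {𝓥 : (j : ℕ) → GaugeField P j G} {U : GaugeField P 0 G} :
    datumE av k Λ U = ofDataE k Λ 𝓥 ↔ ConstraintOn av k Λ 𝓥 U := by
  classical
  constructor
  · intro h j hj b hb
    have h' := congr_fun (congr_fun h j) b
    rwa [datumE_of_mem hj hb, ofDataE_of_mem hj hb] at h'
  · intro h
    funext j b
    by_cases hc : j ≤ k ∧ b ∈ bondsOn j (Λ j)
    · rw [datumE_of_mem hc.1 hc.2, ofDataE_of_mem hc.1 hc.2]; exact h j hc.1 b hc.2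
    · rw [datumE_of_not hc, ofDataE_of_not hc]

/-- **`𝔅_k(𝔅_k, 𝓥)` IS THE ABSTRACT FIBRE**: the cell's `B10NestedMinimizer.fibK` of the datum map over the normal form of the data is the (3)-constraint set.
[cite: Balaban1985Variational, (3) p.278] -/
theorem fibK_datumE (av : ∀ j, Averaging P j G) (k : ℕ) (Λ : ℕ → Set (Site P 0)) (𝓥 : (j : ℕ) → GaugeField P j G) :
    fibK (datumE av k Λ) (ofDataE k Λ 𝓥) = {U | ConstraintOn av k Λ 𝓥 U} := by
  ext U; exact datumE_eq_ofDataE_iff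

/-- The normal form is idempotent. [folklore] -/
theorem ofDataE_idem (𝓥 : (j : ℕ) → GaugeField P j G) : ofDataE k Λ (ofDataE k Λ 𝓥) = ofDataE k Λ 𝓥 := by
  classical
  funext j b
  by_cases hc : j ≤ k ∧ b ∈ bondsOn j (Λ j)
  · rw [ofDataE_of_mem hc.1 hc.2, ofDataE_of_mem hc.1 hc.2]
  · rw [ofDataE_of_not hc, ofDataE_of_not hc]

/-- The datum map takes values in normal forms (`LevelMin.datum`-shape: `C (U) = y` with `y` normalised). [folklore] -/
theorem ofDataE_datumE (U : GaugeField P 0 G) : ofDataE k Λ (datumE av k Λ U) = datumE av k Λ U := by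
  classical
  funext j b
  by_cases hc : j ≤ k ∧ b ∈ bondsOn j (Λ j)
  · rw [ofDataE_of_mem hc.1 hc.2]
  · rw [ofDataE_of_not hc, datumE_of_not hc]

/-- The constraint reads the data only through their normal form. [cite: Balaban1985Variational, (3) p.278] -/
theorem constraintOn_ofDataE_iff {𝓥 : (j : ℕ) → GaugeField P j G} {U : GaugeField P 0 G} :
    ConstraintOn av k Λ (ofDataE k Λ 𝓥) U ↔ ConstraintOn av k Λ 𝓥 U := by
  constructor
  · intro h j hj b hb; have h' := h j hj b hb; rwa [ofDataE_of_mem hj hb] at h'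
  · intro h j hj b hb; rw [ofDataE_of_mem hj hb]; exact h j hj b hb

/-- Data agreeing on the constrained bonds define the same constraint. [cite: Balaban1985Variational, (3) p.278] -/
theorem constraintOn_congr_data {𝓥 𝓥' : (j : ℕ) → GaugeField P j G} (h : ∀ j, j ≤ k → ∀ b : PBond P j, b ∈ bondsOn j (Λ j) → 𝓥 j b = 𝓥' j b)
    {U : GaugeField P 0 G} : ConstraintOn av k Λ 𝓥 U ↔ ConstraintOn av k Λ 𝓥' U := by
  constructor
  · intro hc j hj b hb; rw [← h j hj b hb]; exact hc j hj b hb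
  · intro hc j hj b hb; rw [h j hj b hb]; exact hc j hj b hb

/-- Every configuration satisfies the constraint of its OWN datum (the `(j+1)`- resp. `k`-datum «of `U_k` itself» of the nesting argument). [cite: Balaban1985UV3, (52) p.268] -/
theorem constraintOn_datumE_self (U : GaugeField P 0 G) : ConstraintOn av k Λ (datumE av k Λ U) U :=
  fun _ hj _ hb => (datumE_of_mem hj hb).symm

/-- **`B11Dict.inB_iff` ON NORMALISED DATA**: for data in normal form, the constraint (3) IS the equation `datumE U = 𝓥`. [cite: Balaban1985Variational, (3) p.278] -/
theorem constraintOn_iff_datumE_eq {𝓥 : (j : ℕ) → GaugeField P j G} (h𝓥 : ofDataE k Λ 𝓥 = 𝓥) {U : GaugeField P 0 G} :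
    ConstraintOn av k Λ 𝓥 U ↔ datumE av k Λ U = 𝓥 := by
  rw [← datumE_eq_ofDataE_iff, h𝓥]

end Data

/-! ## §2 The constraint (3) is invariant under print's group (4) — for any averaging family, by covariance (11) -/

section Gauge

omit [GaugeGroup G] in
/-- `transfUp u j y = u (toFine j y)` (the restricted transformation reads `u` at the representative fine site; the (FL) team's `FLContraction.transfUp_eq_toFine`,
re-derived to keep this file's imports light). [cite: Balaban1985Averaging, (11) p.19] -/
private theorem transfUp_eq_toFine' (u : GaugeTransf P 0 G) : ∀ (j : ℕ) (y : Site P j), transfUp u j y = u (toFine j y)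
  | 0, _ => rfl
  | j + 1, y => by
    show transfUp u j (emb y) = u (toFine (j + 1) y)
    rw [transfUp_eq_toFine' u j, toFine_succ]

/-- **(11) ITERATED, AT A BOND**: `(avʲ (U^u)) b = u(toFine j b₋) · (avʲ U) b · u(toFine j b₊)⁻¹` in the standing range `j ≤ m + K`. [cite: Balaban1985Averaging, (11) p.19] -/
theorem iter_gaugeAct_apply (av : ∀ j, Averaging P j G) {j : ℕ} (hj : j ≤ P.m + P.K) (u : GaugeTransf P 0 G) (U : GaugeField P 0 G) (b : PBond P j) :
    Averaging.iter av j (GaugeField.gaugeAct u U) b = u (toFine j b.src) * Averaging.iter av j U b * (u (toFine j (b.src.shift b.dir)))⁻¹ := by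
  rw [iter_gaugeAct av u j hj U]
  show transfUp u j b.src * Averaging.iter av j U b * (transfUp u j b.tgt)⁻¹ = _
  rw [transfUp_eq_toFine', transfUp_eq_toFine']
  rfl

/-- ★ **[Balaban1985Variational] p.278 «the space `𝔅_k(𝔅_k, V)` is invariant with respect to gauge transformations `u` satisfying (4)» — FOR ANY AVERAGING FAMILY**,
unconditionally in the standing range `k ≤ m + K`: `u = 1` at both anchors of every constrained bond and (11). [cite: Balaban1985Variational, (3)–(4) p.278] -/
theorem constraintOn_gaugeAct (av : ∀ j, Averaging P j G) {k : ℕ} (hk : k ≤ P.m + P.K) {Λ : ℕ → Set (Site P 0)} {u : GaugeTransf P 0 G}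
    (hu : TrivialOn k Λ u) {𝓥 : (j : ℕ) → GaugeField P j G} {U : GaugeField P 0 G} (h : ConstraintOn av k Λ 𝓥 U) :
    ConstraintOn av k Λ 𝓥 (GaugeField.gaugeAct u U) := by
  intro j hj b hb
  obtain ⟨h₁, h₂⟩ := hu j hj b hb
  rw [iter_gaugeAct_apply av (hj.trans hk) u U b, h₁, h₂, h j hj b hb, inv_one, one_mul, mul_one]

/-- The normalised datum is (4)-invariant: `datumE (U^u) = datumE U` for `u` in the group (4). [cite: Balaban1985Variational, (4) p.278] -/
theorem datumE_gaugeAct (av : ∀ j, Averaging P j G) {k : ℕ} (hk : k ≤ P.m + P.K) {Λ : ℕ → Set (Site P 0)} {u : GaugeTransf P 0 G}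
    (hu : TrivialOn k Λ u) (U : GaugeField P 0 G) : datumE av k Λ (GaugeField.gaugeAct u U) = datumE av k Λ U := by
  rw [← ofDataE_datumE (av := av) (k := k) (Λ := Λ) U]
  exact datumE_eq_ofDataE_iff.mpr (constraintOn_gaugeAct av hk hu (constraintOn_datumE_self U))

/-- The group (4) is closed under pointwise inverses. [cite: Balaban1985Variational, (4) p.278] -/
theorem trivialOn_inv {k : ℕ} {Λ : ℕ → Set (Site P 0)} {u : GaugeTransf P 0 G} (hu : TrivialOn k Λ u) : TrivialOn k Λ (fun x => (u x)⁻¹) :=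
  fun j hj b hb => by
    obtain ⟨h₁, h₂⟩ := hu j hj b hb
    exact ⟨show (u (toFine j b.src))⁻¹ = 1 by rw [h₁, inv_one], show (u (toFine j (b.src.shift b.dir)))⁻¹ = 1 by rw [h₂, inv_one]⟩

/-- Acting by `u⁻¹` undoes acting by `u`. [folklore] -/
theorem gaugeAct_inv_gaugeAct {j : ℕ} (u : GaugeTransf P j G) (U : GaugeField P j G) :
    GaugeField.gaugeAct (fun x => (u x)⁻¹) (GaugeField.gaugeAct u U) = U := by
  funext b
  show (u b.src)⁻¹ * (u b.src * U b * (u b.tgt)⁻¹) * ((u b.tgt)⁻¹)⁻¹ = U b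
  group

/-- The `↔` form: for `u` in the group (4), `U^u ∈ 𝔅_k(𝔅_k, 𝓥) ↔ U ∈ 𝔅_k(𝔅_k, 𝓥)`. [cite: Balaban1985Variational, (3)–(4) p.278] -/
theorem constraintOn_gaugeAct_iff (av : ∀ j, Averaging P j G) {k : ℕ} (hk : k ≤ P.m + P.K) {Λ : ℕ → Set (Site P 0)} {u : GaugeTransf P 0 G}
    (hu : TrivialOn k Λ u) {𝓥 : (j : ℕ) → GaugeField P j G} {U : GaugeField P 0 G} :
    ConstraintOn av k Λ 𝓥 (GaugeField.gaugeAct u U) ↔ ConstraintOn av k Λ 𝓥 U := by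
  refine ⟨fun h => ?_, constraintOn_gaugeAct av hk hu⟩
  have h' := constraintOn_gaugeAct av hk (trivialOn_inv hu) h
  rwa [gaugeAct_inv_gaugeAct] at h'

end Gauge

end Summit.QuantumFields.YangMills.Theorems.RegionalVP

end
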